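import Mathlib
import Literature.Combinatorics.Posets.BooleanOrderRaising

/-!
# Powers of Stanley's raising operator: `U^c` is one-to-one on `K(B_n)_i` for `2i + c ≤ n` (Gottlieb–Kantor full rank of the
`i`-sets-versus-`(i+c)`-sets inclusion matrix, characteristic `0`) — ENGINE B gen 50 ITEM B50-POWERS (offer o8, LEAD gen 52 R-L532)

certified instances and evidence bearing on the general Hodge conjecture; no claim.

ENGINE B gen 50 ITEM B50-POWERS (offer o8, LEAD gen 52 R-L532) of the HODGE-LOCUS COMPONENT CENSUS (pub-hlocus; evidence class, helper of
stmt-HodgeConjecture-16267; no census number changes; nothing about HC): theorem-only, definition-free, imports `Mathlib` and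
`Literature/Combinatorics/Posets/BooleanOrderRaising.lean` (Stanley, *Algebraic Combinatorics*, Ch. 4: `upOp` = `U`, `downOp` = `D`, Lemma 4.6
`downOp_upOp_sub_upOp_downOp_rank`, the rank bookkeeping and the complementation lemma `downOp_comp_compl`) BY NAME.

PART A (coefficient functions `Finset α → K`, `K` a field; `V_i` = functions supported on the `i`-subsets, `n = |α|`):
* `downOp_upOp_pow` — the `sl₂` rule for powers: `D (U^{c+1} f) = U^{c+1} (D f) + (c+1)(n − 2i − c) · U^c f` for `f ∈ V_i` (induction on `c` from Lemma 4.6);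
* `upOp_pow_eq_zero_imp` — `[CharZero K]`: `f ∈ V_i`, `2i + c ≤ n`, `U^c f = 0 ⇒ f = 0` (double induction on `i` and `c`: apply `D`, then `U`, to reach
  `U^{c+2} (D f) = 0` and the rank-`(i−1)` case; then cancel the nonzero scalar `(c+1)(n − 2i − c)`);
* `downOp_pow_eq_zero_imp` — `f ∈ V_j`, `n + c ≤ 2j`, `D^c f = 0 ⇒ f = 0` (transport along complementation, `downOp_pow_comp_compl`).
PART B (the inclusion matrices `W^{(c)}_j`, rows the `j`-subsets `T`, columns the `(j+c)`-subsets `S` of `α`, entry `[T ⊆ S]`, stated inline with `Matrix.of`):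
* `downOp_pow_apply` — chain count `(D^c F)(T) = c! · Σ_{S ⊇ T, |S| = |T| + c} F(S)`; `incl_pow_mulVec` — `c! · (W^{(c)}_j x)(T) = (D^c x̃)(T)`;
* `rank_incl_pow_into` (`n ≤ 2j + c`: rank `= C(n, j+c)`), `rank_incl_pow_onto` (`2j + c ≤ n`: rank `= C(n, j)`, by `Matrix.rank_transpose` and the complement
  reindex `(W^{(c)}_j)ᵀ ≅ W^{(c)}_{n−j−c}`), `rank_incl_pow` — **`rank W^{(c)}_j = min (C(n,j)) (C(n,j+c))` in characteristic `0`** (Gottlieb 1966; Kantor 1972;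
  Graver–Jurkat 1973; Wilson 1990 gives the modular version, not treated here).  Characteristic `0` matters: `W^{(1)}_1` of a `3`-set has determinant `2`.
USE: with `c = c′` this is THEOREM L's step (e) for every `c′`; the census transfer to anchor 179's `c′ = 2, 3` matrices in every level needs in addition the
list identity `count (flatMap^{c′} (colR 3)) = c′! · [zero set ⊆ zero set]` (successor note, `ENGINEB-g50.md` §7).
-/

set_option linter.dupNamespace false
set_option autoImplicit false

namespace Summit.HodgeConjecture.HodgeConjecture.HodgeLocus.Census.InclusionPowers

open Literature.Combinatorics.Posets.BooleanOrderRaising (upOp downOp upOp_apply downOp_apply upOp_rank downOp_rank downOp_rank_zero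
  downOp_upOp_sub_upOp_downOp_rank downOp_comp_compl)

/-! ## Part A — operator algebra on coefficient functions `Finset α → K` -/

section Operators

variable {K : Type*} [Field K] {α : Type*} [Fintype α] [DecidableEq α]

omit [Fintype α] in
/-- `U^c` raises the rank by `c`. -/
theorem upOp_pow_rank {f : Finset α → K} {i : ℕ} (hf : ∀ S, S.card ≠ i → f S = 0) (c : ℕ) :
    ∀ S : Finset α, S.card ≠ i + c → (upOp (K := K) (α := α) ^ c) f S = 0 := by
  induction c with
  | zero => intro S hS; rw [pow_zero, Module.End.one_apply]; exact hf S (by simpa using hS)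
  | succ c ih =>
    intro S hS
    rw [pow_succ', Module.End.mul_apply]
    exact upOp_rank ih S (by omega)

/-- `D^c` lowers the rank by `c`. -/
theorem downOp_pow_rank {j : ℕ} (c : ℕ) :
    ∀ {f : Finset α → K}, (∀ S, S.card ≠ j + c → f S = 0) → ∀ S : Finset α, S.card ≠ j → (downOp (K := K) (α := α) ^ c) f S = 0 := by
  induction c with
  | zero => intro f hf S hS; rw [pow_zero, Module.End.one_apply]; exact hf S (by simpa using hS)
  | succ c ih =>
    intro f hf S hS
    rw [pow_succ, Module.End.mul_apply]
    exact ih (fun T hT => downOp_rank hf T (by omega)) S hS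

/-- **The `sl₂` commutation rule for powers**: for `f ∈ K(B_n)_i`,
`D(U^{c+1} f) = U^{c+1}(D f) + (c+1)(n − 2i − c)·U^{c} f` (Lemma 4.6 iterated). -/
theorem downOp_upOp_pow {f : Finset α → K} {i : ℕ} (hf : ∀ S, S.card ≠ i → f S = 0) (c : ℕ) :
    downOp ((upOp (K := K) (α := α) ^ (c + 1)) f) =
      (upOp (K := K) (α := α) ^ (c + 1)) (downOp f) +
        (((c + 1 : ℕ) : K) * ((Fintype.card α : K) - 2 * (i : K) - (c : K))) • (upOp (K := K) (α := α) ^ c) f := by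
  induction c with
  | zero =>
    have h := downOp_upOp_sub_upOp_downOp_rank hf
    rw [sub_eq_iff_eq_add'] at h
    rw [zero_add, pow_one, pow_zero, Module.End.one_apply, Nat.cast_one, one_mul, Nat.cast_zero, sub_zero]
    exact h
  | succ c ih =>
    have hg := upOp_pow_rank hf (c + 1)
    have h46 := downOp_upOp_sub_upOp_downOp_rank hg
    rw [sub_eq_iff_eq_add'] at h46
    have e1 : ∀ x : Finset α → K, (upOp (K := K) (α := α) ^ (c + 1 + 1)) x = upOp ((upOp (K := K) (α := α) ^ (c + 1)) x) :=
      fun x => by rw [pow_succ' _ (c + 1), Module.End.mul_apply]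
    have e0 : ∀ x : Finset α → K, upOp ((upOp (K := K) (α := α) ^ c) x) = (upOp (K := K) (α := α) ^ (c + 1)) x :=
      fun x => by rw [pow_succ' _ c, Module.End.mul_apply]
    rw [e1, h46, ih, map_add, map_smul, e0, e1, add_assoc, ← add_smul]
    congr 2
    push_cast
    ring

/-- the scalar `(c+1)(n − 2i − c)` is a nonzero element of a characteristic-`0` field when `2i + c + 1 ≤ n` -/
theorem scalar_ne_zero [CharZero K] {n i c : ℕ} (h : 2 * i + c + 1 ≤ n) :
    (((c + 1 : ℕ) : K) * ((n : K) - 2 * (i : K) - (c : K))) ≠ 0 := by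
  have h1 : ((n : K) - 2 * (i : K) - (c : K)) = ((n - 2 * i - c : ℕ) : K) := by
    rw [Nat.cast_sub (by omega), Nat.cast_sub (by omega), Nat.cast_mul, Nat.cast_two]
  rw [h1]
  exact mul_ne_zero (Nat.cast_ne_zero.mpr (by omega)) (Nat.cast_ne_zero.mpr (by omega))

/-- **`U^c` is one-to-one on `K(B_n)_i` when `2i + c ≤ n`** (characteristic `0`; `c = 1` is Stanley's Theorem 4.7). Double induction
on `i` and `c` through the commutation rule: applying `D` to `U^{c+1} f = 0` and `U` once more gives `U^{c+2}(D f) = 0`, so `D f = 0`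
by the rank-`(i−1)` case, whence `(c+1)(n−2i−c)·U^c f = 0` and the rank-`i`, power-`c` case finishes. -/
theorem upOp_pow_eq_zero_imp [CharZero K] :
    ∀ (i c : ℕ) (f : Finset α → K), (∀ S, S.card ≠ i → f S = 0) → 2 * i + c ≤ Fintype.card α →
      (upOp (K := K) (α := α) ^ c) f = 0 → f = 0 := by
  have e1 : ∀ (c : ℕ) (x : Finset α → K), upOp ((upOp (K := K) (α := α) ^ (c + 1)) x) = (upOp (K := K) (α := α) ^ (c + 1 + 1)) x :=
    fun c x => by rw [pow_succ' _ (c + 1), Module.End.mul_apply]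
  have e0 : ∀ (c : ℕ) (x : Finset α → K), upOp ((upOp (K := K) (α := α) ^ c) x) = (upOp (K := K) (α := α) ^ (c + 1)) x :=
    fun c x => by rw [pow_succ' _ c, Module.End.mul_apply]
  intro i
  induction i with
  | zero =>
    intro c
    induction c with
    | zero => intro f _ _ h0; rwa [pow_zero, Module.End.one_apply] at h0
    | succ c ihc =>
      intro f hf hle h0
      have hD : downOp (K := K) (α := α) f = 0 := downOp_rank_zero hf
      have key := downOp_upOp_pow hf c
      rw [h0, map_zero, hD, map_zero, zero_add] at key
      have hs := scalar_ne_zero (K := K) (n := Fintype.card α) (i := 0) (c := c) (by omega)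
      have hUc : (upOp (K := K) (α := α) ^ c) f = 0 := (smul_eq_zero.mp key.symm).resolve_left hs
      exact ihc f hf (by omega) hUc
  | succ i ihi =>
    intro c
    induction c with
    | zero => intro f _ _ h0; rwa [pow_zero, Module.End.one_apply] at h0
    | succ c ihc =>
      intro f hf hle h0
      have hDf : ∀ S : Finset α, S.card ≠ i → downOp (K := K) (α := α) f S = 0 := fun S hS => downOp_rank hf S hS
      have key := downOp_upOp_pow hf c
      rw [h0, map_zero] at key
      have hU2 : (upOp (K := K) (α := α) ^ (c + 1 + 1)) (downOp f) = 0 := by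
        have h1 := congrArg (upOp (K := K) (α := α)) key
        rw [map_zero, map_add, map_smul, e1, e0, h0, smul_zero, add_zero] at h1
        exact h1.symm
      have hD0 : downOp (K := K) (α := α) f = 0 := ihi (c + 1 + 1) (downOp f) hDf (by omega) hU2
      rw [hD0, map_zero, zero_add] at key
      have hs := scalar_ne_zero (K := K) (n := Fintype.card α) (i := i + 1) (c := c) (by omega)
      have hUc : (upOp (K := K) (α := α) ^ c) f = 0 := (smul_eq_zero.mp key.symm).resolve_left hs
      exact ihc f hf (by omega) hUc

/-- complementation intertwines the powers: `D^c (f ∘ ᶜ) = (U^c f) ∘ ᶜ` -/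
theorem downOp_pow_comp_compl (f : Finset α → K) (c : ℕ) :
    (downOp (K := K) (α := α) ^ c) (fun T => f Tᶜ) = fun S => (upOp (K := K) (α := α) ^ c) f Sᶜ := by
  induction c with
  | zero => funext S; rw [pow_zero, pow_zero, Module.End.one_apply, Module.End.one_apply]
  | succ c ih =>
    funext S
    rw [pow_succ', Module.End.mul_apply, ih, downOp_comp_compl, pow_succ', Module.End.mul_apply]

/-- **`D^c` is one-to-one on `K(B_n)_j` when `n + c ≤ 2j`** (transport of `upOp_pow_eq_zero_imp` along complementation). -/
theorem downOp_pow_eq_zero_imp [CharZero K] {f : Finset α → K} {j : ℕ} (c : ℕ) (hf : ∀ S, S.card ≠ j → f S = 0)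
    (hj : Fintype.card α + c ≤ 2 * j) (h : (downOp (K := K) (α := α) ^ c) f = 0) : f = 0 := by
  by_cases hjn : j ≤ Fintype.card α
  · set g : Finset α → K := fun T => f Tᶜ with hg
    have hg' : ∀ S : Finset α, S.card ≠ Fintype.card α - j → g S = 0 := by
      intro S hS
      apply hf
      intro hc
      apply hS
      have h1 := Finset.card_compl S
      have h2 := Finset.card_le_univ S
      omega
    have hfg : (fun T => g Tᶜ) = f := funext fun T => by simp only [hg, compl_compl]
    have hU : (upOp (K := K) (α := α) ^ c) g = 0 := by
      have h1 := downOp_pow_comp_compl g c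
      rw [hfg, h] at h1
      funext T
      have h2 := congrFun h1 Tᶜ
      simp only [hg, Pi.zero_apply, compl_compl] at h2
      rw [hg]
      exact h2.symm
    have hg0 : g = 0 := upOp_pow_eq_zero_imp (Fintype.card α - j) c g hg' (by omega) hU
    rw [← hfg, hg0]
    rfl
  · funext S
    exact hf S (by have := Finset.card_le_univ S; omega)

end Operators


/-! ## Part B — the `c`-step inclusion matrices `W^{(c)}_{j}` (rows `j`-subsets, columns `(j+c)`-subsets of `α`, entry `[T ⊆ S]`) -/

section Matrices

variable (K : Type*) [Field K] {α : Type*} [Fintype α] [DecidableEq α]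

/-- the swap lemma behind the chain count: summing `F (insert a S)` over the `c`-step supersets `S` of `T` and `a ∉ S` hits every
`(c+1)`-step superset `S'` of `T` exactly `|S' ∖ T| = c + 1` times -/
theorem sum_supersets_succ (F : Finset α → K) (T : Finset α) (c : ℕ) :
    ∑ S ∈ Finset.univ.filter (fun S : Finset α => T ⊆ S ∧ S.card = T.card + c), ∑ a ∈ Sᶜ, F (insert a S) =
      ((c + 1 : ℕ) : K) * ∑ S ∈ Finset.univ.filter (fun S : Finset α => T ⊆ S ∧ S.card = T.card + (c + 1)), F S := by
  rw [Finset.mul_sum, Finset.sum_sigma', show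
    (∑ S ∈ Finset.univ.filter (fun S : Finset α => T ⊆ S ∧ S.card = T.card + (c + 1)), ((c + 1 : ℕ) : K) * F S) =
      ∑ S ∈ Finset.univ.filter (fun S : Finset α => T ⊆ S ∧ S.card = T.card + (c + 1)), ∑ a ∈ S \ T, F S from
    Finset.sum_congr rfl fun S hS => by
      rw [Finset.sum_const, nsmul_eq_mul]
      obtain ⟨hTS, hcard⟩ := (Finset.mem_filter.mp hS).2
      rw [Finset.card_sdiff_of_subset hTS, hcard, Nat.add_sub_cancel_left],
    Finset.sum_sigma']
  refine Finset.sum_bij' (fun p _ => ⟨insert p.2 p.1, p.2⟩) (fun p _ => ⟨p.1.erase p.2, p.2⟩) ?_ ?_ ?_ ?_ ?_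
  · rintro ⟨S, a⟩ hp
    obtain ⟨hS, ha⟩ := Finset.mem_sigma.mp hp
    obtain ⟨hTS, hcard⟩ := (Finset.mem_filter.mp hS).2
    have haS : a ∉ S := Finset.mem_compl.mp ha
    refine Finset.mem_sigma.mpr ⟨Finset.mem_filter.mpr ⟨Finset.mem_univ _, hTS.trans (Finset.subset_insert a S), ?_⟩, ?_⟩
    · rw [Finset.card_insert_of_notMem haS, hcard]; omega
    · exact Finset.mem_sdiff.mpr ⟨Finset.mem_insert_self a S, fun haT => haS (hTS haT)⟩
  · rintro ⟨S, a⟩ hp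
    obtain ⟨hS, ha⟩ := Finset.mem_sigma.mp hp
    obtain ⟨hTS, hcard⟩ := (Finset.mem_filter.mp hS).2
    obtain ⟨haS, haT⟩ := Finset.mem_sdiff.mp ha
    refine Finset.mem_sigma.mpr ⟨Finset.mem_filter.mpr ⟨Finset.mem_univ _, fun x hx => ?_, ?_⟩, ?_⟩
    · exact Finset.mem_erase.mpr ⟨fun hxa => haT (hxa ▸ hx), hTS hx⟩
    · rw [Finset.card_erase_of_mem haS, hcard]; rfl
    · exact Finset.mem_compl.mpr (Finset.notMem_erase a S)
  · rintro ⟨S, a⟩ hp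
    obtain ⟨hS, ha⟩ := Finset.mem_sigma.mp hp
    have haS : a ∉ S := Finset.mem_compl.mp ha
    show (⟨(insert a S).erase a, a⟩ : Σ _ : Finset α, α) = ⟨S, a⟩
    rw [Finset.erase_insert haS]
  · rintro ⟨S, a⟩ hp
    obtain ⟨hS, ha⟩ := Finset.mem_sigma.mp hp
    obtain ⟨haS, haT⟩ := Finset.mem_sdiff.mp ha
    show (⟨insert a (S.erase a), a⟩ : Σ _ : Finset α, α) = ⟨S, a⟩
    rw [Finset.insert_erase haS]
  · rintro ⟨S, a⟩ hp
    rfl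

/-- **Chain count**: `(D^c F)(T) = c! · Σ_{S ⊇ T, |S| = |T| + c} F(S)`. -/
theorem downOp_pow_apply (F : Finset α → K) (c : ℕ) (T : Finset α) :
    (downOp (K := K) (α := α) ^ c) F T =
      (c.factorial : K) * ∑ S ∈ Finset.univ.filter (fun S : Finset α => T ⊆ S ∧ S.card = T.card + c), F S := by
  induction c generalizing F T with
  | zero =>
    have hT : Finset.univ.filter (fun S : Finset α => T ⊆ S ∧ S.card = T.card + 0) = {T} := by
      ext S
      rw [Finset.mem_filter, Finset.mem_singleton, Nat.add_zero]
      constructor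
      · rintro ⟨-, hTS, hcard⟩
        exact (Finset.eq_of_subset_of_card_le hTS hcard.le).symm
      · rintro rfl
        exact ⟨Finset.mem_univ _, Finset.Subset.refl _, rfl⟩
    rw [pow_zero, Module.End.one_apply, hT, Finset.sum_singleton, Nat.factorial_zero, Nat.cast_one, one_mul]
  | succ c ih =>
    rw [pow_succ, Module.End.mul_apply, ih (downOp F) T]
    simp_rw [downOp_apply]
    rw [sum_supersets_succ K F T c, ← mul_assoc]
    congr 1
    rw [Nat.factorial_succ, Nat.cast_mul, mul_comm]

omit [DecidableEq α] in
/-- sums over the `m`-subsets as a subtype versus as a filter of `Finset.univ` -/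
theorem sum_subtype_card (m : ℕ) (G : Finset α → K) :
    ∑ S : {S : Finset α // S.card = m}, G S.1 = ∑ S ∈ Finset.univ.filter (fun S : Finset α => S.card = m), G S :=
  (Finset.sum_subtype _ (fun S => by simp) G).symm

/-- **The inclusion matrix computes `D^c / c!`**: for `x` on the `(j+c)`-subsets extended by zero to all subsets (`x̃`),
`c! · (W^{(c)}_j · x)(T) = (D^c x̃)(T)` at every `j`-subset `T`. -/
theorem incl_pow_mulVec (j c : ℕ) (x : {S : Finset α // S.card = j + c} → K) (T : {S : Finset α // S.card = j}) :
    (c.factorial : K) * ((Matrix.of fun (T : {S : Finset α // S.card = j}) (S : {S : Finset α // S.card = j + c}) =>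
        if T.1 ⊆ S.1 then (1 : K) else 0).mulVec x) T =
      (downOp (K := K) (α := α) ^ c) (fun U => if h : U.card = j + c then x ⟨U, h⟩ else 0) T.1 := by
  rw [downOp_pow_apply, T.2]
  congr 1
  have hs : (Finset.univ.filter fun S : Finset α => T.1 ⊆ S ∧ S.card = j + c) =
      (Finset.univ.filter fun S : Finset α => S.card = j + c).filter fun S => T.1 ⊆ S := by
    ext S; simp only [Finset.mem_filter, Finset.mem_univ, true_and]; exact and_comm
  simp only [Matrix.mulVec, dotProduct, Matrix.of_apply, ite_mul, one_mul, zero_mul]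
  rw [hs, Finset.sum_filter, ← sum_subtype_card K (j + c)]
  refine Finset.sum_congr rfl fun S _ => ?_
  simp only [dif_pos S.2, Subtype.coe_eta]

/-- **INTO** (operator `D^c / c!`): `x ↦ W^{(c)}_j · x` is one-to-one when `n ≤ 2j + c`. -/
theorem incl_pow_mulVecLin_injective [CharZero K] {j c : ℕ} (hj : Fintype.card α ≤ 2 * j + c) :
    Function.Injective (Matrix.of fun (T : {S : Finset α // S.card = j}) (S : {S : Finset α // S.card = j + c}) =>
        if T.1 ⊆ S.1 then (1 : K) else 0).mulVecLin := by
  rw [← LinearMap.ker_eq_bot, LinearMap.ker_eq_bot']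
  intro x hx
  rw [Matrix.mulVecLin_apply] at hx
  set xt : Finset α → K := fun U => if h : U.card = j + c then x ⟨U, h⟩ else 0 with hxt
  have hxt' : ∀ U : Finset α, U.card ≠ j + c → xt U = 0 := fun U hU => by simp only [hxt, dif_neg hU]
  have hD : (downOp (K := K) (α := α) ^ c) xt = 0 := by
    funext U
    rw [Pi.zero_apply]
    by_cases hU : U.card = j
    · have h1 := incl_pow_mulVec K j c x ⟨U, hU⟩
      rw [hx, Pi.zero_apply, mul_zero] at h1
      exact h1.symm
    · exact downOp_pow_rank c hxt' U hU
  have h0 : xt = 0 := downOp_pow_eq_zero_imp c hxt' (by omega) hD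
  funext S
  have h1 := congrFun h0 S.1
  simp only [hxt, dif_pos S.2, Subtype.coe_eta, Pi.zero_apply] at h1
  exact h1

/-- **Rank, INTO regime** `n ≤ 2j + c`: `rank W^{(c)}_j = C(n, j+c)` (the number of columns). -/
theorem rank_incl_pow_into [CharZero K] (j c : ℕ) (hj : Fintype.card α ≤ 2 * j + c) :
    (Matrix.of fun (T : {S : Finset α // S.card = j}) (S : {S : Finset α // S.card = j + c}) =>
        if T.1 ⊆ S.1 then (1 : K) else 0).rank = (Fintype.card α).choose (j + c) := by
  rw [Matrix.rank, LinearMap.finrank_range_of_inj (incl_pow_mulVecLin_injective K hj), Module.finrank_fintype_fun_eq_card,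
    Fintype.card_finset_len]

/-- **Rank, ONTO regime** `2j + c ≤ n`: `rank W^{(c)}_j = C(n, j)` (the number of rows) — by transposition and complementation
`(W^{(c)}_j)ᵀ ≅ W^{(c)}_{n−j−c}`, which is INTO. -/
theorem rank_incl_pow_onto [CharZero K] (j c : ℕ) (hj : 2 * j + c ≤ Fintype.card α) :
    (Matrix.of fun (T : {S : Finset α // S.card = j}) (S : {S : Finset α // S.card = j + c}) =>
        if T.1 ⊆ S.1 then (1 : K) else 0).rank = (Fintype.card α).choose j := by
  have hjc : j + c ≤ Fintype.card α := by omega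
  let e : Finset α ≃ Finset α := ⟨compl, compl, compl_compl, compl_compl⟩
  let eR : {S : Finset α // S.card = j + c} ≃ {R : Finset α // R.card = Fintype.card α - j - c} :=
    e.subtypeEquiv fun S => by
      show S.card = j + c ↔ Sᶜ.card = Fintype.card α - j - c
      rw [Finset.card_compl]; have := Finset.card_le_univ S; omega
  let eC : {T : Finset α // T.card = j} ≃ {Q : Finset α // Q.card = Fintype.card α - j - c + c} :=
    e.subtypeEquiv fun T => by
      show T.card = j ↔ Tᶜ.card = Fintype.card α - j - c + c
      rw [Finset.card_compl]; have := Finset.card_le_univ T; omega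
  have hre : Matrix.reindex eR.symm eC.symm (Matrix.of fun (R : {R : Finset α // R.card = Fintype.card α - j - c})
      (Q : {Q : Finset α // Q.card = Fintype.card α - j - c + c}) => if R.1 ⊆ Q.1 then (1 : K) else 0) =
      Matrix.transpose (Matrix.of fun (T : {S : Finset α // S.card = j}) (S : {S : Finset α // S.card = j + c}) =>
        if T.1 ⊆ S.1 then (1 : K) else 0) := by
    ext S T
    simp only [Matrix.reindex_apply, Matrix.submatrix_apply, Matrix.transpose_apply, Matrix.of_apply, Equiv.symm_symm]
    have h1 : (eR S).1 = S.1ᶜ := rfl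
    have h2 : (eC T).1 = T.1ᶜ := rfl
    rw [h1, h2]
    exact if_congr Finset.compl_subset_compl rfl rfl
  rw [← Matrix.rank_transpose, ← hre, Matrix.rank_reindex, rank_incl_pow_into K (α := α) (Fintype.card α - j - c) c (by omega),
    show Fintype.card α - j - c + c = Fintype.card α - j by omega, Nat.choose_symm (by omega : j ≤ Fintype.card α)]

/-- **Gottlieb–Kantor (characteristic `0`)**: the `j`-subsets-versus-`(j+c)`-subsets inclusion matrix of an `n`-set has full rank
`min (C(n,j), C(n,j+c))`. -/
theorem rank_incl_pow [CharZero K] (j c : ℕ) :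
    (Matrix.of fun (T : {S : Finset α // S.card = j}) (S : {S : Finset α // S.card = j + c}) =>
        if T.1 ⊆ S.1 then (1 : K) else 0).rank = min ((Fintype.card α).choose j) ((Fintype.card α).choose (j + c)) := by
  by_cases h : 2 * j + c ≤ Fintype.card α
  · have h1 := rank_incl_pow_onto K j c h
    have h2 := Matrix.rank_le_card_width (Matrix.of fun (T : {S : Finset α // S.card = j}) (S : {S : Finset α // S.card = j + c}) =>
      if T.1 ⊆ S.1 then (1 : K) else 0)
    rw [Fintype.card_finset_len, h1] at h2
    rw [h1, eq_comm, min_eq_left_iff]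
    exact h2
  · have h1 := rank_incl_pow_into K (α := α) j c (by omega)
    have h2 := Matrix.rank_le_card_height (Matrix.of fun (T : {S : Finset α // S.card = j}) (S : {S : Finset α // S.card = j + c}) =>
      if T.1 ⊆ S.1 then (1 : K) else 0)
    rw [Fintype.card_finset_len, h1] at h2
    rw [h1, eq_comm, min_eq_right_iff]
    exact h2

end Matrices

end Summit.HodgeConjecture.HodgeConjecture.HodgeLocus.Census.InclusionPowers
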